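import Mathlib.Analysis.Complex.Basic
import Mathlib.LinearAlgebra.Matrix.BilinearForm
import Mathlib.LinearAlgebra.Matrix.ConjTranspose
import Mathlib.LinearAlgebra.Dimension.OrzechProperty
import Mathlib.LinearAlgebra.Eigenspace.Basic
import Mathlib.LinearAlgebra.FiniteDimensional.Lemmas
import HarnessLib

/-!
# Complexification of rational coordinate vectors and the eigenvector count for a Weil operator

Family `hodge`, layer `Literature/AlgebraicGeometry/Motives`. Linear algebra for the signature of
the rational degree-one model `(M, G)` of a Weil-type abelian variety (`M² = -d` the matrix of
`φ^* = (√-d)^*` in a rational basis of `H¹`, `G` the alternating Gram matrix of the polarization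
pairing, `Mᵀ G M = d G`; B. van Geemen, LNM 1594 (1994), Lemma 5.2), read in coordinates
`ℚ^N ↪ ℂ^N` (`v ↦ v_ℂ = Rat.castHom ℂ ∘ v`, `M ↦ M_ℂ = M.map (Rat.castHom ℂ)`):

* `map_ratCast_mulVec_comp`, `ratCast_comp_dotProduct`, `star_ratCast_comp`,
  `map_ratCast_mulVec_star`, `ratCast_comp_sum_smul` — the cast commutes with `M ·`, `·`, is real,
  and is `ℚ`-linear;
* `top_le_span_ratCast_comp`, `linearIndependent_ratCast_comp` — **a rational basis of `ℚ^N` stays a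
  basis of `ℂ^N`** (spanning transfers through the standard basis; `N` spanning vectors of `ℂ^N`
  are independent);
* `map_mulVec_frameVec`, `frameVec_pairing`, `linearIndependent_frameVec` — **the eigenvectors
  `f_v = (M v)_ℂ + μ v_ℂ` of `M_ℂ`** for `μ² = -d` (`M_ℂ f_v = μ f_v`), their pairing
  `f_v · (G M)_ℂ f̄_w = 2 d · (v · G M w) - 2 μ d · (v · G w)` (`μ̄ = -μ`), and their independence;
* `eigenspace_inf_eigenspace_neg_eq_bot_of_ne_zero`, `finrank_eigenspace_le_of_linearIndependent_neg` —
  `V_μ ∩ V_{-μ} = 0` and `dim V_μ ≤ 2n'` in `ℂ^{4n'}` when `V_{-μ}` contains `2n'` independent vectors;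
* `dotProduct_mulVec_star_sum`, `card_filter_nonpos_le_of_definite` — **the eigenvector count**
  (van Geemen's proof of Lemma 5.2 (4)–(5) in coordinates): if `f_1, …, f_m` are independent
  `μ`-eigenvectors with `f_j · S f̄_l = δ_{jl} · 2 d q_j`, `dim V_μ ≤ 2n'`, and `D ⊆ V_μ` is an
  `n'`-dimensional subspace on which `s · Re(x · S x̄) > 0`, then `#{j | s q_j ≤ 0} ≤ n'` (the span
  of those `f_j` is a subspace of `V_μ` on which `s · Re(x · S x̄) ≤ 0`, so it meets `D` in `0`).

Everything is proved; no definition and no named fact is introduced.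

## References

* [vanGeemen1994HodgeAV] B. van Geemen, LNM 1594 (1994), Lemma 5.2 (2), (4), (5) and proof.
-/

noncomputable section

open Module
open scoped Matrix ComplexConjugate

namespace Literature.AlgebraicGeometry.Motives

section Complexify

variable {N : ℕ}

/-- `M_ℂ · v_ℂ = (M v)_ℂ` for a rational matrix and a rational vector. [folklore] -/
theorem map_ratCast_mulVec_comp (M : Matrix (Fin N) (Fin N) ℚ) (v : Fin N → ℚ) :
    M.map (Rat.castHom ℂ : ℚ →+* ℂ) *ᵥ ((Rat.castHom ℂ : ℚ →+* ℂ) ∘ v) = (Rat.castHom ℂ : ℚ →+* ℂ) ∘ (M *ᵥ v) :=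
  funext fun i => (RingHom.map_mulVec (Rat.castHom ℂ : ℚ →+* ℂ) M v i).symm

/-- `v_ℂ · w_ℂ = (v · w)_ℂ`. [folklore] -/
theorem ratCast_comp_dotProduct (v w : Fin N → ℚ) : ((Rat.castHom ℂ : ℚ →+* ℂ) ∘ v) ⬝ᵥ ((Rat.castHom ℂ : ℚ →+* ℂ) ∘ w) = (Rat.castHom ℂ : ℚ →+* ℂ) (v ⬝ᵥ w) :=
  (RingHom.map_dotProduct (Rat.castHom ℂ : ℚ →+* ℂ) v w).symm

/-- Rational vectors are real: `star v_ℂ = v_ℂ`. [folklore] -/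
theorem star_ratCast_comp (v : Fin N → ℚ) : star ((Rat.castHom ℂ : ℚ →+* ℂ) ∘ v) = (Rat.castHom ℂ : ℚ →+* ℂ) ∘ v :=
  funext fun i => by
    change starRingEnd ℂ ((v i : ℚ) : ℂ) = ((v i : ℚ) : ℂ)
    exact map_ratCast _ _

/-- A rational matrix commutes with complex conjugation of vectors. [folklore] -/
theorem map_ratCast_mulVec_star (M : Matrix (Fin N) (Fin N) ℚ) (x : Fin N → ℂ) :
    M.map (Rat.castHom ℂ : ℚ →+* ℂ) *ᵥ star x = star (M.map (Rat.castHom ℂ : ℚ →+* ℂ) *ᵥ x) := by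
  funext i
  simp only [Matrix.mulVec, dotProduct, Pi.star_apply, Matrix.map_apply, star_sum, star_mul',
    Rat.coe_castHom]
  refine Finset.sum_congr rfl fun k _ => ?_
  congr 1
  rw [Complex.star_def]
  exact (map_ratCast _ _).symm

/-- `(q • v)_ℂ = q • v_ℂ` and additivity: the complexification of a rational combination. [folklore] -/
theorem ratCast_comp_sum_smul {κ : Type*} (s : Finset κ) (c : κ → ℚ) (b : κ → Fin N → ℚ) :
    ((Rat.castHom ℂ : ℚ →+* ℂ) ∘ (∑ j ∈ s, c j • b j) : Fin N → ℂ) = ∑ j ∈ s, ((c j : ℚ) : ℂ) • ((Rat.castHom ℂ : ℚ →+* ℂ) ∘ b j) := by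
  funext i
  simp only [Function.comp_apply, Finset.sum_apply, Pi.smul_apply, smul_eq_mul, Rat.coe_castHom,
    Rat.cast_sum, Rat.cast_mul]

/-- **A rational spanning family spans after complexification.** [folklore] -/
theorem top_le_span_ratCast_comp {κ : Type*} [Fintype κ] {b : κ → Fin N → ℚ}
    (hb : ⊤ ≤ Submodule.span ℚ (Set.range b)) :
    ⊤ ≤ Submodule.span ℂ (Set.range fun j => ((Rat.castHom ℂ : ℚ →+* ℂ) ∘ b j : Fin N → ℂ)) := by
  have hsingle : ∀ i : Fin N, (fun k => if i = k then (1 : ℂ) else 0) ∈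
      Submodule.span ℂ (Set.range fun j => ((Rat.castHom ℂ : ℚ →+* ℂ) ∘ b j : Fin N → ℂ)) := by
    intro i
    have hmem : (fun k => if i = k then (1 : ℚ) else 0) ∈ Submodule.span ℚ (Set.range b) :=
      hb Submodule.mem_top
    obtain ⟨c, hc⟩ := (Submodule.mem_span_range_iff_exists_fun ℚ).1 hmem
    have hc' : (fun k => if i = k then (1 : ℂ) else 0) = ∑ j, ((c j : ℚ) : ℂ) • ((Rat.castHom ℂ : ℚ →+* ℂ) ∘ b j) := by
      rw [← ratCast_comp_sum_smul, hc]
      funext k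
      simp only [Function.comp_apply, Rat.coe_castHom]
      split_ifs <;> simp
    rw [hc']
    exact Submodule.sum_mem _ fun j _ => Submodule.smul_mem _ _ (Submodule.subset_span ⟨j, rfl⟩)
  intro x _
  rw [pi_eq_sum_univ x]
  exact Submodule.sum_mem _ fun i _ => Submodule.smul_mem _ _ (hsingle i)

/-- **A rational basis stays linearly independent after complexification.** [folklore] -/
theorem linearIndependent_ratCast_comp {κ : Type*} [Fintype κ] {b : κ → Fin N → ℚ}
    (hb : LinearIndependent ℚ b) (hcard : Fintype.card κ = N) :
    LinearIndependent ℂ fun j => ((Rat.castHom ℂ : ℚ →+* ℂ) ∘ b j : Fin N → ℂ) := by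
  have hspan : Submodule.span ℚ (Set.range b) = ⊤ :=
    hb.span_eq_top_of_card_eq_finrank' (by rw [hcard, Module.finrank_fin_fun])
  exact linearIndependent_of_top_le_span_of_card_eq_finrank (top_le_span_ratCast_comp hspan.ge)
    (by rw [hcard, Module.finrank_fin_fun])

/-- Expanding a bilinear map on two finite combinations of two frames. [folklore] -/
theorem bilin_sum_smul_sum_smul_two {V W : Type*} [AddCommGroup V] [Module ℂ V] [AddCommGroup W]
    [Module ℂ W] {ι : Type*} [Fintype ι] (B : V →ₗ[ℂ] V →ₗ[ℂ] W) (a c : ι → ℂ) (u u' : ι → V) :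
    B (∑ i, a i • u i) (∑ j, c j • u' j) = ∑ i, ∑ j, (a i * c j) • B (u i) (u' j) := by
  have h1 : ∀ j, B (∑ i, a i • u i) (c j • u' j) = ∑ i, (a i * c j) • B (u i) (u' j) := by
    intro j
    rw [LinearMap.map_smul, map_sum, LinearMap.sum_apply, Finset.smul_sum]
    refine Finset.sum_congr rfl fun i _ => ?_
    rw [LinearMap.map_smul, LinearMap.smul_apply, smul_smul, mul_comm]
  rw [map_sum]
  simp_rw [h1]
  rw [Finset.sum_comm]

end Complexify

section Frame

variable {N : ℕ}

/-- **The eigenvectors `f = (M v)_ℂ + μ v_ℂ`** of `M_ℂ` for `μ² = -d = M²`. [folklore] -/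
theorem map_mulVec_frameVec (M : Matrix (Fin N) (Fin N) ℚ) {d : ℚ} (hM2 : ∀ v, M *ᵥ (M *ᵥ v) = -(d • v))
    {μ : ℂ} (hμ : μ * μ = -((d : ℚ) : ℂ)) (v : Fin N → ℚ) :
    M.map (Rat.castHom ℂ : ℚ →+* ℂ) *ᵥ (((Rat.castHom ℂ : ℚ →+* ℂ) ∘ (M *ᵥ v) : Fin N → ℂ) + μ • ((Rat.castHom ℂ : ℚ →+* ℂ) ∘ v)) =
      μ • (((Rat.castHom ℂ : ℚ →+* ℂ) ∘ (M *ᵥ v) : Fin N → ℂ) + μ • ((Rat.castHom ℂ : ℚ →+* ℂ) ∘ v)) := by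
  rw [Matrix.mulVec_add, Matrix.mulVec_smul, map_ratCast_mulVec_comp, map_ratCast_mulVec_comp, hM2, smul_add,
    smul_smul, hμ, add_comm]
  congr 1
  funext i
  simp only [Function.comp_apply, Pi.neg_apply, Pi.smul_apply, smul_eq_mul, Rat.coe_castHom,
    Rat.cast_neg, Rat.cast_mul, neg_mul]

/-- The symmetric rational form `S(v, w) = v · G M w` and `E(v, w) = v · G w` control the
complexified pairing of two frame vectors:
`f_v · (G M)_ℂ f̄_w = 2 d S(v, w) - 2 μ d E(v, w)` (`μ² = -d`, `μ̄ = -μ`). [folklore] -/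
theorem frameVec_pairing (M G : Matrix (Fin N) (Fin N) ℚ) {d : ℚ}
    (hM2 : ∀ v, M *ᵥ (M *ᵥ v) = -(d • v))
    (hW : ∀ x y : Fin N → ℚ, M *ᵥ x ⬝ᵥ G *ᵥ (M *ᵥ y) = d * (x ⬝ᵥ G *ᵥ y))
    {μ : ℂ} (hμ : μ * μ = -((d : ℚ) : ℂ)) (hμs : star μ = -μ) (v w : Fin N → ℚ) :
    (((Rat.castHom ℂ : ℚ →+* ℂ) ∘ (M *ᵥ v) : Fin N → ℂ) + μ • ((Rat.castHom ℂ : ℚ →+* ℂ) ∘ v)) ⬝ᵥ (G.map (Rat.castHom ℂ : ℚ →+* ℂ) * M.map (Rat.castHom ℂ : ℚ →+* ℂ)) *ᵥ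
        star (((Rat.castHom ℂ : ℚ →+* ℂ) ∘ (M *ᵥ w) : Fin N → ℂ) + μ • ((Rat.castHom ℂ : ℚ →+* ℂ) ∘ w)) =
      ((2 * d * (v ⬝ᵥ G *ᵥ (M *ᵥ w)) : ℚ) : ℂ) - 2 * μ * ((d * (v ⬝ᵥ G *ᵥ w) : ℚ) : ℂ) := by
  -- the four rational values
  have hS : ∀ a b : Fin N → ℚ, ((Rat.castHom ℂ : ℚ →+* ℂ) ∘ a : Fin N → ℂ) ⬝ᵥ (G.map (Rat.castHom ℂ : ℚ →+* ℂ) * M.map (Rat.castHom ℂ : ℚ →+* ℂ)) *ᵥ ((Rat.castHom ℂ : ℚ →+* ℂ) ∘ b) =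
      ((a ⬝ᵥ G *ᵥ (M *ᵥ b) : ℚ) : ℂ) := fun a b => by
    rw [← Matrix.mulVec_mulVec, map_ratCast_mulVec_comp, map_ratCast_mulVec_comp, ratCast_comp_dotProduct]
    rfl
  have e1 : (M *ᵥ v) ⬝ᵥ G *ᵥ (M *ᵥ (M *ᵥ w)) = d * (v ⬝ᵥ G *ᵥ (M *ᵥ w)) := hW v (M *ᵥ w)
  have e2 : (M *ᵥ v) ⬝ᵥ G *ᵥ (M *ᵥ w) = d * (v ⬝ᵥ G *ᵥ w) := hW v w
  have e3 : v ⬝ᵥ G *ᵥ (M *ᵥ (M *ᵥ w)) = -(d * (v ⬝ᵥ G *ᵥ w)) := by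
    rw [hM2, Matrix.mulVec_neg, Matrix.mulVec_smul, dotProduct_neg, dotProduct_smul, smul_eq_mul]
  have hB : ∀ x y : Fin N → ℂ, x ⬝ᵥ (G.map (Rat.castHom ℂ : ℚ →+* ℂ) * M.map (Rat.castHom ℂ : ℚ →+* ℂ)) *ᵥ y =
      Matrix.toBilin' (G.map (Rat.castHom ℂ : ℚ →+* ℂ) * M.map (Rat.castHom ℂ : ℚ →+* ℂ)) x y := fun x y => (Matrix.toBilin'_apply' _ x y).symm
  rw [star_add, star_smul, hμs, star_ratCast_comp, star_ratCast_comp, hB]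
  simp only [map_add, map_smul, LinearMap.add_apply, LinearMap.smul_apply, smul_eq_mul, ← hB, hS,
    e1, e2, e3]
  push_cast
  linear_combination (-((v ⬝ᵥ G *ᵥ (M *ᵥ w) : ℚ) : ℂ)) * hμ

/-- **Independence of the eigenvector family** from that of the complexified frame
`(e_j)_ℂ ⊔ (M e_j)_ℂ`. [folklore] -/
theorem linearIndependent_frameVec (M : Matrix (Fin N) (Fin N) ℚ) {m : ℕ} (e : Fin m → Fin N → ℚ)
    (hb : LinearIndependent ℂ fun x => ((Rat.castHom ℂ : ℚ →+* ℂ) ∘ Sum.elim e (fun j => M *ᵥ e j) x : Fin N → ℂ))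
    (μ : ℂ) :
    LinearIndependent ℂ fun j => (((Rat.castHom ℂ : ℚ →+* ℂ) ∘ (M *ᵥ e j) : Fin N → ℂ) + μ • ((Rat.castHom ℂ : ℚ →+* ℂ) ∘ e j)) := by
  rw [Fintype.linearIndependent_iff] at hb ⊢
  intro a ha j
  have h := hb (Sum.elim (fun j => a j * μ) a) (by
    rw [Fintype.sum_sum_type]
    simp only [Sum.elim_inl, Sum.elim_inr]
    rw [← ha, ← Finset.sum_add_distrib]
    refine Finset.sum_congr rfl fun j _ => ?_
    rw [smul_add, smul_smul, add_comm])
  exact h (Sum.inr j)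

end Frame

section Count

variable {N : ℕ}

/-- Two eigenspaces of an endomorphism for `μ` and `-μ ≠ μ` meet in `0`. [folklore] -/
theorem eigenspace_inf_eigenspace_neg_eq_bot_of_ne_zero {M : Type*} [AddCommGroup M] [Module ℂ M]
    (T : Module.End ℂ M) {μ : ℂ} (hμ : μ ≠ 0) :
    Module.End.eigenspace T μ ⊓ Module.End.eigenspace T (-μ) = ⊥ := by
  rw [Submodule.eq_bot_iff]
  intro x hx
  obtain ⟨h1, h2⟩ := Submodule.mem_inf.1 hx
  rw [Module.End.mem_eigenspace_iff] at h1 h2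
  have h : (2 * μ) • x = 0 := by
    rw [mul_smul, two_smul]
    nth_rewrite 1 [← h1]
    rw [h2, neg_smul, neg_add_cancel]
  rcases smul_eq_zero.1 h with h | h
  · exact absurd h (mul_ne_zero two_ne_zero hμ)
  · exact h

/-- **Dimension bound for an eigenspace**: if `-μ ≠ μ` has `2n'` independent eigenvectors in
`ℂ^{4n'}`, then `dim V_μ ≤ 2n'`. [folklore] -/
theorem finrank_eigenspace_le_of_linearIndependent_neg {n' : ℕ} (hN : N = 4 * n') (T : Module.End ℂ (Fin N → ℂ)) {μ : ℂ}
    (hμ : μ ≠ 0) (g : Fin (2 * n') → Fin N → ℂ) (hg : LinearIndependent ℂ g)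
    (hgμ : ∀ j, T (g j) = (-μ) • g j) :
    finrank ℂ (Module.End.eigenspace T μ) ≤ 2 * n' := by
  have hle : Submodule.span ℂ (Set.range g) ≤ Module.End.eigenspace T (-μ) :=
    Submodule.span_le.2 (by
      rintro _ ⟨j, rfl⟩
      exact Module.End.mem_eigenspace_iff.2 (hgμ j))
  have h1 : 2 * n' ≤ finrank ℂ (Module.End.eigenspace T (-μ)) := by
    have h := Submodule.finrank_mono hle
    rwa [finrank_span_eq_card hg, Fintype.card_fin] at h
  have h2 := Submodule.finrank_sup_add_finrank_inf_eq (Module.End.eigenspace T μ)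
    (Module.End.eigenspace T (-μ))
  rw [eigenspace_inf_eigenspace_neg_eq_bot_of_ne_zero T hμ, finrank_bot, add_zero] at h2
  have h3 := Submodule.finrank_le (Module.End.eigenspace T μ ⊔ Module.End.eigenspace T (-μ))
  rw [Module.finrank_fin_fun] at h3
  omega

/-- **The quadratic form on the span of orthogonal eigenvectors.** If
`f_j · S f̄_l = δ_{jl} · c_j` with `c_j` real, then for `z = Σ a_j f_j`,
`z · S z̄ = Σ |a_j|² c_j`. [folklore] -/
theorem dotProduct_mulVec_star_sum {m : ℕ} (S : Matrix (Fin N) (Fin N) ℂ) (f : Fin m → Fin N → ℂ)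
    (c : Fin m → ℝ) (hSf : ∀ j l, f j ⬝ᵥ S *ᵥ star (f l) = if j = l then (c j : ℂ) else 0)
    (s : Finset (Fin m)) (a : Fin m → ℂ) :
    (∑ j ∈ s, a j • f j) ⬝ᵥ S *ᵥ star (∑ j ∈ s, a j • f j) =
      ∑ j ∈ s, ((Complex.normSq (a j) * c j : ℝ) : ℂ) := by
  classical
  -- extend by zero and use the bilinear expansion over `univ`
  have hsum : ∑ j ∈ s, a j • f j = ∑ j, (if j ∈ s then a j else 0) • f j := by
    have h1 : ∑ j ∈ s, a j • f j = ∑ j ∈ s, (if j ∈ s then a j else 0) • f j :=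
      Finset.sum_congr rfl fun j hj => by rw [if_pos hj]
    rw [h1]
    exact Finset.sum_subset (Finset.subset_univ s) fun j _ hj => by rw [if_neg hj, zero_smul]
  have hstar : star (∑ j, (if j ∈ s then a j else 0) • f j) =
      ∑ j, (starRingEnd ℂ (if j ∈ s then a j else 0)) • star (f j) := by
    rw [star_sum]
    exact Finset.sum_congr rfl fun j _ => by rw [star_smul, Complex.star_def]
  rw [hsum, hstar, ← Matrix.toBilin'_apply', bilin_sum_smul_sum_smul_two]
  simp_rw [Matrix.toBilin'_apply', hSf, smul_ite, smul_zero, Finset.sum_ite_eq, Finset.mem_univ,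
    if_true, smul_eq_mul]
  have h2 : ∑ j ∈ s, ((Complex.normSq (a j) * c j : ℝ) : ℂ) =
      ∑ j ∈ s, (if j ∈ s then a j else 0) * starRingEnd ℂ (if j ∈ s then a j else 0) * (c j : ℂ) :=
    Finset.sum_congr rfl fun j hj => by rw [if_pos hj, Complex.ofReal_mul, ← Complex.mul_conj]
  rw [h2]
  symm
  exact Finset.sum_subset (Finset.subset_univ s) fun j _ hj => by rw [if_neg hj, zero_mul, zero_mul]

/-- **The eigenvector count.** Let `f_1, …, f_m` be independent `μ`-eigenvectors of `T` in
`ℂ^N` with `f_j · S f̄_l = δ_{jl} · 2 d q_j` (`d > 0`, `q_j ∈ ℚ`), `dim V_μ ≤ 2n'`, and let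
`D ⊆ V_μ` be an `n'`-dimensional subspace on which `s · Re(x · S x̄) > 0` (`x ≠ 0`). Then at
least `n'` of the `q_j` satisfy `s q_j > 0`: the span of the `f_j` with `s q_j ≤ 0` is a subspace
of `V_μ` on which `s · Re(x · S x̄) ≤ 0`, hence meets `D` trivially. [cite: vanGeemen1994HodgeAV, proof of Lemma 5.2 (4)–(5)] -/
theorem card_filter_nonpos_le_of_definite {m n' : ℕ} (T : Module.End ℂ (Fin N → ℂ)) (S : Matrix (Fin N) (Fin N) ℂ)
    {μ : ℂ} (f : Fin m → Fin N → ℂ) (hf : LinearIndependent ℂ f) (hfμ : ∀ j, T (f j) = μ • f j)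
    {d : ℚ} (hd : 0 < d) (q : Fin m → ℚ)
    (hSf : ∀ j l, f j ⬝ᵥ S *ᵥ star (f l) = if j = l then (((2 * d * q j : ℚ) : ℝ) : ℂ) else 0)
    (hVμ : finrank ℂ (Module.End.eigenspace T μ) ≤ 2 * n') (s : ℚ)
    (D : Submodule ℂ (Fin N → ℂ)) (hD : D ≤ Module.End.eigenspace T μ) (hDn : finrank ℂ D = n')
    (hpos : ∀ x ∈ D, x ≠ 0 → 0 < (s : ℝ) * (x ⬝ᵥ S *ᵥ star x).re) :
    (Finset.univ.filter fun j => s * q j ≤ 0).card ≤ n' := by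
  classical
  set J : Finset (Fin m) := Finset.univ.filter fun j => s * q j ≤ 0 with hJ
  set Z : Submodule ℂ (Fin N → ℂ) := Submodule.span ℂ (Set.range fun j : J => f j) with hZ
  -- `Z ⊆ V_μ`
  have hZle : Z ≤ Module.End.eigenspace T μ :=
    Submodule.span_le.2 (by
      rintro _ ⟨j, rfl⟩
      exact Module.End.mem_eigenspace_iff.2 (hfμ j))
  -- `dim Z = #J`
  have hfJ : LinearIndependent ℂ (fun j : J => f j) :=
    hf.comp (fun j : J => (j : Fin m)) Subtype.val_injective
  have hZr : finrank ℂ Z = J.card := by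
    rw [hZ, finrank_span_eq_card hfJ, Fintype.card_coe]
  -- the form is `≤ 0` on `Z` (after the sign `s`)
  have hZneg : ∀ z ∈ Z, (s : ℝ) * (z ⬝ᵥ S *ᵥ star z).re ≤ 0 := by
    intro z hz
    obtain ⟨a, rfl⟩ := (Submodule.mem_span_range_iff_exists_fun ℂ).1 hz
    -- rewrite the sum over the subtype `J` as a sum over the finset `J`
    have hrw : ∑ j : J, a j • f j = ∑ j ∈ J, (fun j => if h : j ∈ J then a ⟨j, h⟩ else 0) j • f j := by
      rw [← Finset.sum_coe_sort J]
      refine Finset.sum_congr rfl fun j _ => ?_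
      show a j • f j = (if h : (j : Fin m) ∈ J then a ⟨j, h⟩ else 0) • f j
      rw [dif_pos j.2]
    rw [hrw, dotProduct_mulVec_star_sum S f (fun j => ((2 * d * q j : ℚ) : ℝ)) hSf J]
    rw [Complex.re_sum, Finset.mul_sum]
    refine Finset.sum_nonpos fun j hj => ?_
    rw [Complex.ofReal_re]
    have hj' : s * q j ≤ 0 := (Finset.mem_filter.1 hj).2
    have h1 : 0 ≤ Complex.normSq ((fun j => if h : j ∈ J then a ⟨j, h⟩ else 0) j) := Complex.normSq_nonneg _
    have h2 : (s : ℝ) * ((2 * d * q j : ℚ) : ℝ) ≤ 0 := by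
      have : ((s * (2 * d * q j) : ℚ) : ℝ) ≤ 0 := by
        have hq : s * (2 * d * q j) ≤ 0 := by nlinarith
        exact_mod_cast hq
      push_cast at this ⊢
      linarith
    nlinarith
  -- `D ⊓ Z = ⊥`
  have hDZ : D ⊓ Z = ⊥ := by
    rw [Submodule.eq_bot_iff]
    intro x hx
    obtain ⟨hxD, hxZ⟩ := Submodule.mem_inf.1 hx
    by_contra hx0
    have h1 := hpos x hxD hx0
    have h2 := hZneg x hxZ
    linarith
  -- count dimensions inside `V_μ`
  have hsup : finrank ℂ ↥(D ⊔ Z) ≤ 2 * n' :=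
    (Submodule.finrank_mono (sup_le hD hZle)).trans hVμ
  have hadd := Submodule.finrank_sup_add_finrank_inf_eq D Z
  rw [hDZ, finrank_bot, add_zero, hDn, hZr] at hadd
  omega

end Count

end Literature.AlgebraicGeometry.Motives

end
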